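import Summits.NavierStokesRegularity.FluidComputer.RotorKnobDouse
import HarnessLib

/-!
# The seed–rotor scale knob, part 6 of 6: Theorem 5.3 along the seed–rotor scale

Last part of `RotorKnob*.lean` (cell `pub-fluidc`, blueprint seat bp1, gen 22; namespace
`Summit.NavierStokesRegularity.FluidComputer.RotorKnob`).
HONEST FRAMING: low prior, high value-of-information experiment on Tao's machine paradigm; NOT a
claim that NS blows up.
Five-mode ODE analysis of [Tao2016AveragedNS, §5.5] with the clock/amplifier scale `ε` and the
seed/rotor scale `ρ` kept apart; nothing is proved about Navier–Stokes.

THIS FILE: `beable_of_sum_sq` ((beable) with constant `200` from `∑_{i≠4} Xᵢ² ≤ 143K⁻²⁰`), (able)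
`able_window` (`a = 1 + O(K⁻¹⁰)`, the rest `O(K⁻¹⁰)` on all of `[0, τ]`), the thresholds
`clock_facts`, `rho_facts`, and the MAIN RESULTS. `transition_explicit`: for
`K ≥ K₀ = 2·20⁴²·42! + 16`, `3000 log K ≤ M ≤ K¹⁰`, every POLYNOMIAL clock `0 < ε ≤ K⁻¹⁰⁰`, every
seed–rotor scale `0 < ρ` with `ρ⁴ ≤ ε²e^{-18M}/(64M)` and every trajectory of `rotorCircuit K M ε ρ`
from `delayInit`: a critical time `|t_c - √2| ≤ 24 log K/M`, quiet at level `200K⁻¹⁰` on ALL of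
`[0, t_c]`, fired at level `200K⁻¹⁰` from `t_c + 880 log K/M + 1/√K` on — the windows of
`Thm53With.transitionWith_explicit`, uniformly in `ρ`. `internalTimescales`: the internal clocks
((boots), (c-bound), (c-large), (atc), (beable)) — the LEVELS scale with `ρ²`, the TIMES do not see
`ρ`. `rotorScaleTransition`: the `∃ C K₀ ρ₁`-form (`C = 3000`, `ρ₁ = (ε²e^{-18M}/(64M))^{1/4}`).
A closing `example` re-derives the tree's `transitionWith_explicit` on the diagonal `ρ = ε`
(consistency; it declares nothing — v1's `theorem transitionWith_of_rotorKnob` had literally the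
statement of that landed theorem, which the gate's dedup lint refuses). So the exponential
scale separation that the printed proof of Theorem 5.3 needs is certified as a condition on the
SEED–ROTOR scale relative to the clock (`ρ² ≤ εe^{-9M}/(8√M)`), with a power-law clock — for every
amplifier `M ≤ K¹⁰` including Tao's `M = K¹⁰` (compare `AmplitudeKnob.lean`, gen 20: on the
diagonal `ρ = ε` the certified amplitude threshold is `e^{-700·M·log K/K}/K¹⁸⁰⁰`). This is a
SUFFICIENT condition; no necessity statement about `ρ` is made here (the one-sided necessity laws
of the gate are in `GateBudget*.lean`, gen 21).
[cite: Tao2016AveragedNS, Theorem 5.3, §5.5]. No named facts; 0 sorry.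
-/

noncomputable section

namespace Summit.NavierStokesRegularity.FluidComputer.RotorKnob

open Set Real Filter
open _root_.Topology
open Literature.Analysis.FluidPDE.Tao2016AveragedNS
open Literature.Analysis.FluidPDE.Tao2016AveragedNS.Thm53 (antitoneOn_intFactor monotoneOn_intFactor
  antitoneOn_sub_of_deriv_le monotoneOn_sub_of_le_deriv exists_hitTime abs_sub_le_of_abs_deriv_le
  sqrt_two_gt sqrt_two_lt invSqrt_facts Es_alg decay_alg numeric_N4 init_a init_b init_c init_d
  init_e)

section Windows

variable {K M ε ρ τ δ : ℝ} {X : ℝ → Fin 5 → ℝ}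

/-- From `∑_{i≠4} Xᵢ² ≤ 143K⁻²⁰` and (energy-con): all of (beable) with constant `200`.
[cite: Tao2016AveragedNS, §5.5 (beable)] -/
theorem beable_of_sum_sq (hX : ∀ t, HasDerivAt X (rotorCircuit K M ε ρ (X t)) t)
    (h0 : X 0 = delayInit) (hK : 16 ≤ K) {t : ℝ} (ht0 : 0 ≤ t)
    (hS : X t 0 ^ 2 + X t 1 ^ 2 + X t 2 ^ 2 + X t 3 ^ 2 ≤ 143 / K ^ 20) :
    |X t 4 - 1| ≤ 200 / K ^ 10 ∧ ∀ i : Fin 5, i ≠ 4 → |X t i| ≤ 200 / K ^ 10 := by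
  have hK0 : 0 < K := by linarith
  have hK1 : 1 ≤ K := by linarith
  have hsum := traj_sum_sq_eq_one hX h0 t
  have he0 : 0 ≤ X t 4 := e_nonneg hX h0 hK0.le ht0
  have he1 : X t 4 ≤ 1 := (le_abs_self _).trans (traj_abs_le_one hX h0 t 4)
  have h2010 : 143 / K ^ 20 ≤ 143 / K ^ 10 := by
    apply div_le_div_of_nonneg_left (by norm_num) (by positivity)
    exact pow_le_pow_right₀ hK1 (by norm_num)
  have h143 : 143 / K ^ 10 ≤ 200 / K ^ 10 :=
    div_le_div_of_nonneg_right (by norm_num) (by positivity)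
  have hsq : ∀ x : ℝ, x ^ 2 ≤ 143 / K ^ 20 → |x| ≤ 200 / K ^ 10 := by
    intro x hx
    have hx' : x ^ 2 ≤ (12 / K ^ 10) ^ 2 := by
      rw [div_pow, show (K ^ 10) ^ 2 = K ^ 20 by ring]
      exact hx.trans (div_le_div_of_nonneg_right (by norm_num) (by positivity))
    calc |x| ≤ sqrt ((12 / K ^ 10) ^ 2) := abs_le_sqrt hx'
      _ = 12 / K ^ 10 := sqrt_sq (by positivity)
      _ ≤ 200 / K ^ 10 := div_le_div_of_nonneg_right (by norm_num) (by positivity)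
  have hx0 : X t 0 ^ 2 ≤ 143 / K ^ 20 := by
    nlinarith [sq_nonneg (X t 1), sq_nonneg (X t 2), sq_nonneg (X t 3)]
  have hx1 : X t 1 ^ 2 ≤ 143 / K ^ 20 := by
    nlinarith [sq_nonneg (X t 0), sq_nonneg (X t 2), sq_nonneg (X t 3)]
  have hx2 : X t 2 ^ 2 ≤ 143 / K ^ 20 := by
    nlinarith [sq_nonneg (X t 0), sq_nonneg (X t 1), sq_nonneg (X t 3)]
  have hx3 : X t 3 ^ 2 ≤ 143 / K ^ 20 := by
    nlinarith [sq_nonneg (X t 0), sq_nonneg (X t 1), sq_nonneg (X t 2)]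
  have ha := hsq _ hx0
  have hb := hsq _ hx1
  have hc := hsq _ hx2
  have hd := hsq _ hx3
  refine ⟨?_, ?_⟩
  · rw [abs_sub_comm, abs_of_nonneg (by linarith)]
    have : 1 - X t 4 ≤ 1 - X t 4 ^ 2 := by nlinarith
    linarith
  · intro i hi
    fin_cases i
    · exact ha
    · exact hb
    · exact hc
    · exact hd
    · exact absurd rfl hi

/-- (able2) with constant `200`: on `[0, t_c]`. [cite: Tao2016AveragedNS, §5.5 (able2)] -/
theorem able_window (hX : ∀ t, HasDerivAt X (rotorCircuit K M ε ρ (X t)) t) (h0 : X 0 = delayInit)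
    (hε : 0 < ε) (hρ : 0 < ρ) (hρε : ρ ^ 2 ≤ ε) (hM0 : 0 ≤ M) (hK : 16 ≤ K)
    (hεK : ε ^ 2 ≤ 1 / (6 * K ^ 20))
    (hε100 : ε ≤ 1 / K ^ 100) (hτ2 : τ ≤ 2)
    (hcτ : ∀ t, 0 ≤ t → t ≤ τ → X t 2 ≤ ρ ^ 2 / K ^ 10)
    {t : ℝ} (ht : t ∈ Icc 0 τ) :
    |X t 0 - 1| ≤ 200 / K ^ 10 ∧ ∀ i : Fin 5, i ≠ 0 → |X t i| ≤ 200 / K ^ 10 := by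
  have hK0 : 0 < K := by linarith
  have hK1 : 1 ≤ K := by linarith
  have ht2 : t ∈ Icc (0 : ℝ) 2 := ⟨ht.1, ht.2.trans hτ2⟩
  have ha := a_near_one hX h0 hε hρ hρε hM0 hK1 hτ2 hεK hcτ ht
  obtain ⟨hb, hc⟩ := bc_small hX h0 hε hρ hρε hM0 ht2
  obtain ⟨hd, he⟩ := de_small hX h0 hρ hK0 hτ2 hcτ ht
  have h20 : 8 / K ^ 20 ≤ 200 / K ^ 10 := by
    calc 8 / K ^ 20 ≤ 8 / K ^ 10 := by
          apply div_le_div_of_nonneg_left (by norm_num) (by positivity)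
          exact pow_le_pow_right₀ hK1 (by norm_num)
      _ ≤ 200 / K ^ 10 := div_le_div_of_nonneg_right (by norm_num) (by positivity)
  have h5 : 5 * ε ≤ 200 / K ^ 10 := by
    have h1 : 1 / K ^ 100 ≤ 1 / K ^ 10 := by
      apply div_le_div_of_nonneg_left (by norm_num) (by positivity)
      exact pow_le_pow_right₀ hK1 (by norm_num)
    have h2 : 5 * (1 / K ^ 10) ≤ 200 / K ^ 10 := by
      rw [mul_one_div]; exact div_le_div_of_nonneg_right (by norm_num) (by positivity)
    linarith
  have h3 : 3 / K ^ 10 ≤ 200 / K ^ 10 := div_le_div_of_nonneg_right (by norm_num) (by positivity)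
  have hb' := hb.trans h5
  have hc' := hc.trans h5
  have hd' := hd.trans h3
  have he' := he.trans h3
  refine ⟨ha.trans h20, ?_⟩
  intro i hi
  fin_cases i
  · exact absurd rfl hi
  · exact hb'
  · exact hc'
  · exact hd'
  · exact he'

end Windows

/-! ## Assembly: Theorem 5.3 for every admissible seed–rotor scale `ρ` -/

/-- Clock facts from the POLYNOMIAL clock condition `ε ≤ K⁻¹⁰⁰` (`K ≥ 16`): `ε ≤ 1` and
`ε² ≤ 1/(6K²⁰)`.
[cite: Tao2016AveragedNS, Theorem 5.3 ("`ε` sufficiently small depending on `K`")] -/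
theorem clock_facts {K ε : ℝ} (hK : 16 ≤ K) (hε : 0 < ε) (hε100 : ε ≤ 1 / K ^ 100) :
    ε ≤ 1 ∧ ε ^ 2 ≤ 1 / (6 * K ^ 20) := by
  have hK0 : 0 < K := by linarith
  have hK1 : 1 ≤ K := by linarith
  have hK100 : (1 : ℝ) ≤ K ^ 100 := one_le_pow₀ hK1
  have h1 : ε ≤ 1 := hε100.trans (by rw [div_le_iff₀ (by positivity)]; linarith)
  refine ⟨h1, ?_⟩
  have h2 : ε ^ 2 ≤ (1 / K ^ 100) ^ 2 := pow_le_pow_left₀ hε.le hε100 2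
  refine h2.trans ?_
  rw [div_pow, one_pow, div_le_div_iff₀ (by positivity) (by positivity), one_mul, one_mul]
  calc 6 * K ^ 20 ≤ K ^ 180 * K ^ 20 := by
        have : (6 : ℝ) ≤ K ^ 180 := by
          have : (16 : ℝ) ^ 180 ≤ K ^ 180 := pow_le_pow_left₀ (by norm_num) hK 180
          linarith
        exact mul_le_mul_of_nonneg_right this (by positivity)
    _ = (K ^ 100) ^ 2 := by ring

/-- Scale facts from the seed–rotor condition `ρ⁴ ≤ ε²e^{-18M}/(64M)` (`M ≥ 1`): `ρ² ≤ ε` and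
`Mρ⁴ ≤ ε²` (the two weaker conditions used before the critical time).
[cite: Tao2016AveragedNS, §5.5 (roles of `ε²e^{-K¹⁰}` and `ε⁻²`)] -/
theorem rho_facts {M ε ρ : ℝ} (hM : 1 ≤ M) (hε : 0 < ε)
    (hρexp : ρ ^ 4 ≤ ε ^ 2 * exp (-(18 * M)) / (64 * M)) :
    ρ ^ 2 ≤ ε ∧ M * ρ ^ 4 ≤ ε ^ 2 := by
  have hM0 : 0 < M := by linarith
  have hε2 : 0 < ε ^ 2 := by positivity
  have hexp1 : exp (-(18 * M)) ≤ 1 := by rw [exp_le_one_iff, neg_nonpos]; positivity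
  have h1 : ε ^ 2 * exp (-(18 * M)) / (64 * M) ≤ ε ^ 2 / (64 * M) := by
    apply div_le_div_of_nonneg_right _ (by positivity)
    calc ε ^ 2 * exp (-(18 * M)) ≤ ε ^ 2 * 1 := mul_le_mul_of_nonneg_left hexp1 hε2.le
      _ = ε ^ 2 := mul_one _
  have h2 : ρ ^ 4 ≤ ε ^ 2 / (64 * M) := hρexp.trans h1
  have h3 : ε ^ 2 / (64 * M) ≤ ε ^ 2 := by
    rw [div_le_iff₀ (by positivity)]; nlinarith
  have h4 : ρ ^ 4 ≤ ε ^ 2 := h2.trans h3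
  refine ⟨?_, ?_⟩
  · have h5 : (ρ ^ 2) ^ 2 ≤ ε ^ 2 := by rw [← pow_mul]; exact h4
    exact le_of_pow_le_pow_left₀ two_ne_zero hε.le h5
  · calc M * ρ ^ 4 ≤ M * (ε ^ 2 / (64 * M)) := mul_le_mul_of_nonneg_left h2 hM0.le
      _ = ε ^ 2 / 64 := by field_simp
      _ ≤ ε ^ 2 := by nlinarith


/-! ## Theorem 5.3 along the seed–rotor scale -/

/-- **Theorem 5.3 for the two-scale family, explicit constants.** For `K ≥ K₀ = 2·20⁴²·42! + 16`,
`3000 log K ≤ M ≤ K¹⁰`, every polynomial clock `0 < ε ≤ K⁻¹⁰⁰`, every seed–rotor scale `0 < ρ` with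
`ρ⁴ ≤ ε²e^{-18M}/(64M)`, and every trajectory of `rotorCircuit K M ε ρ` from `delayInit`: a critical
time with `|t_c - √2| ≤ 24 log K / M`, the quiet window ALL of `[0, t_c]` at level `200K⁻¹⁰`, the
fired window from `t_c + 880 log K / M + 1/√K` on at level `200K⁻¹⁰` — the windows of
`transitionWith_explicit`, uniformly in `ρ`. Framing: low prior, high value-of-information
experiment on Tao's machine paradigm; NOT a claim that NS blows up.
[cite: Tao2016AveragedNS, Theorem 5.3, §5.5] -/
theorem transition_explicit {K M ε ρ : ℝ} {X : ℝ → Fin 5 → ℝ}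
    (hK : 2 * 20 ^ 42 * (Nat.factorial 42 : ℝ) + 16 ≤ K) (hML : 3000 * Real.log K ≤ M)
    (hMK : M ≤ K ^ 10) (hε : 0 < ε) (hε100 : ε ≤ 1 / K ^ 100)
    (hρ : 0 < ρ) (hρexp : ρ ^ 4 ≤ ε ^ 2 * exp (-(18 * M)) / (64 * M))
    (h0 : X 0 = delayInit) (hX : ∀ t, HasDerivAt X (rotorCircuit K M ε ρ (X t)) t) :
    ∃ tc : ℝ, |tc - Real.sqrt 2| ≤ 24 * Real.log K / M ∧
      (∀ t ∈ Set.Icc 0 tc,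
        |X t 0 - 1| ≤ 200 / K ^ 10 ∧ ∀ i : Fin 5, i ≠ 0 → |X t i| ≤ 200 / K ^ 10) ∧
      (∀ t, tc + 880 * Real.log K / M + 1 / Real.sqrt K ≤ t →
        |X t 4 - 1| ≤ 200 / K ^ 10 ∧ ∀ i : Fin 5, i ≠ 4 → |X t i| ≤ 200 / K ^ 10) := by
  obtain ⟨hK16, hM0, hML48, hlog2, hN4, hδ, hon, hδle, h2M⟩ :=
    Thm53With.family_params hK hML
  have hK0 : 0 < K := by linarith
  obtain ⟨hε1, hεK⟩ := clock_facts hK16 hε hε100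
  have hM1 : 1 ≤ M := by linarith
  obtain ⟨hρε, hMρ⟩ := rho_facts hM1 hε hρexp
  -- the critical time: first hitting time of the level `K⁻¹⁰ρ²` by `c` on `[0,2]`
  obtain ⟨τ, hτ0, hτ2, hcτ, hτeq⟩ := exists_hitTime (continuous_traj hX 2)
    (θ := ρ ^ 2 / K ^ 10) (T := 2) two_pos (by rw [init_c h0]; positivity)
  obtain ⟨hlo, hhi, hτ1, hτ32, hcτeq⟩ :=
    tc_window hX h0 hε hρ hρε hM0 hMK hK16 hML48 hεK hMρ hτ0 hτ2 hcτ hτeq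
  have hfit : τ + 880 * Real.log K / M + (sqrt K)⁻¹ ≤ 2 :=
    Thm53With.window_fits hK16 hτ1 hhi h2M hδle
  refine ⟨τ, Thm53With.abs_sub_sqrt_two_le hτ1 (div_nonneg (by linarith) hM0.le)
      (div_le_div_of_nonneg_right (by linarith) hM0.le) hlo hhi, ?_, ?_⟩
  · -- (able), on all of `[0, t_c]`
    intro t ht
    exact able_window hX h0 hε hρ hρε hM0.le hK16 hεK hε100 hτ2 hcτ ht
  · -- (beable)
    intro t ht
    have ht0 : 0 ≤ t := by
      have : 0 < (sqrt K)⁻¹ := (invSqrt_facts hK16).1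
      rw [one_div] at ht; linarith
    exact beable_of_sum_sq hX h0 hK16 ht0
      (late_sum_sq hX h0 hε hε1 hρ hρε hM0 hMK hK16 hεK hMρ hε100 hρexp hδ hon hN4 hτ1 hfit
        hcτ hcτeq ht)

/-- **The internal time-scales along the seed–rotor scale**: for every trajectory as in
`transition_explicit`, a critical time `t_c` with `|t_c - √2| ≤ 24 log K / M`, `1 ≤ t_c ≤ 3/2`;
(boots)/(c-bound) `c ≤ K⁻¹⁰ρ²` on `[0,t_c]` with equality at `t_c`; (c-large) `c ≥ K¹⁰⁰ρ²` on
`[t_c + 880 log K/M, 2]`; (atc) `ã(t_c + 880 log K/M + 1/K) ≥ 1/10`; and from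
`t_c + 880 log K/M + 1/√K` on the non-output energy is `≤ 143K⁻²⁰`. The trigger and firing LEVELS
scale with `ρ²`; the TIMES do not depend on `ρ`.
[cite: Tao2016AveragedNS, §5.5 ((boots), (c-bound), (c-large), (atc), (beable))] -/
theorem internalTimescales {K M ε ρ : ℝ} {X : ℝ → Fin 5 → ℝ}
    (hK : 2 * 20 ^ 42 * (Nat.factorial 42 : ℝ) + 16 ≤ K) (hML : 3000 * Real.log K ≤ M)
    (hMK : M ≤ K ^ 10) (hε : 0 < ε) (hε100 : ε ≤ 1 / K ^ 100)
    (hρ : 0 < ρ) (hρexp : ρ ^ 4 ≤ ε ^ 2 * exp (-(18 * M)) / (64 * M))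
    (h0 : X 0 = delayInit) (hX : ∀ t, HasDerivAt X (rotorCircuit K M ε ρ (X t)) t) :
    ∃ tc : ℝ, |tc - Real.sqrt 2| ≤ 24 * Real.log K / M ∧ 1 ≤ tc ∧ tc ≤ 3 / 2 ∧
      (∀ t ∈ Set.Icc 0 tc, X t 2 ≤ ρ ^ 2 / K ^ 10) ∧ X tc 2 = ρ ^ 2 / K ^ 10 ∧
      (∀ t ∈ Set.Icc (tc + 880 * Real.log K / M) 2, K ^ 100 * ρ ^ 2 ≤ X t 2) ∧
      1 / 10 ≤ X (tc + 880 * Real.log K / M + 1 / K) 4 ∧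
      (∀ t, tc + 880 * Real.log K / M + 1 / Real.sqrt K ≤ t →
        X t 0 ^ 2 + X t 1 ^ 2 + X t 2 ^ 2 + X t 3 ^ 2 ≤ 143 / K ^ 20) := by
  obtain ⟨hK16, hM0, hML48, hlog2, hN4, hδ, hon, hδle, h2M⟩ :=
    Thm53With.family_params hK hML
  have hK0 : 0 < K := by linarith
  obtain ⟨hε1, hεK⟩ := clock_facts hK16 hε hε100
  have hM1 : 1 ≤ M := by linarith
  obtain ⟨hρε, hMρ⟩ := rho_facts hM1 hε hρexp
  obtain ⟨τ, hτ0, hτ2, hcτ, hτeq⟩ := exists_hitTime (continuous_traj hX 2)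
    (θ := ρ ^ 2 / K ^ 10) (T := 2) two_pos (by rw [init_c h0]; positivity)
  obtain ⟨hlo, hhi, hτ1, hτ32, hcτeq⟩ :=
    tc_window hX h0 hε hρ hρε hM0 hMK hK16 hML48 hεK hMρ hτ0 hτ2 hcτ hτeq
  have hfit : τ + 880 * Real.log K / M + (sqrt K)⁻¹ ≤ 2 :=
    Thm53With.window_fits hK16 hτ1 hhi h2M hδle
  refine ⟨τ, Thm53With.abs_sub_sqrt_two_le hτ1 (div_nonneg (by linarith) hM0.le)
      (div_le_div_of_nonneg_right (by linarith) hM0.le) hlo hhi, hτ1, hτ32,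
    fun t ht => hcτ t ht.1 ht.2, hcτeq, ?_, ?_, ?_⟩
  · intro t ht
    exact c_large hX h0 hε hρ hρε hM0 hK16 hεK hMρ hρexp hδ hon hτ1 hτ2 hcτ hcτeq ht
  · rw [one_div K]
    exact e_tenth hX h0 hε hε1 hρ hρε hM0 hMK hK16 hεK hMρ hρexp hδ hon hτ1 hfit hcτ hcτeq
  · intro t ht
    exact late_sum_sq hX h0 hε hε1 hρ hρε hM0 hMK hK16 hεK hMρ hε100 hρexp hδ hon hN4 hτ1 hfit
      hcτ hcτeq ht

/-- **Theorem 5.3 along the seed–rotor scale, `∃ C K₀ ρ₁`-form.** For `K ≥ K₀`,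
`C log K ≤ M ≤ K¹⁰` and EVERY polynomial clock `0 < ε ≤ K⁻¹⁰⁰` there is a seed–rotor scale
`ρ₁(K,M,ε) > 0` such that for all `0 < ρ ≤ ρ₁` every trajectory of `rotorCircuit K M ε ρ` from
`delayInit` makes the delayed abrupt transition with the windows of `DelayedAbruptTransitionWith`
(`RetunedTransition.lean`); here `C = 3000`, `K₀ = 2·20⁴²·42! + 16`,
`ρ₁ = (ε²e^{-18M}/(64M))^{1/4}`, `t_c` = the first time `c` reaches `K⁻¹⁰ρ²`. Stated directly as a
theorem (no `def … : Prop`). Framing: low prior, high value-of-information experiment on Tao's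
machine paradigm; NOT a claim that NS blows up. [cite: Tao2016AveragedNS, Theorem 5.3, §5.5] -/
theorem rotorScaleTransition :
    ∃ C : ℝ, 0 < C ∧ ∃ K₀ : ℝ, 0 < K₀ ∧ ∀ K : ℝ, K₀ ≤ K → ∀ M : ℝ, C * Real.log K ≤ M → M ≤ K ^ 10 →
      ∀ ε : ℝ, 0 < ε → ε ≤ 1 / K ^ 100 → ∃ ρ₁ : ℝ, 0 < ρ₁ ∧ ∀ ρ : ℝ, 0 < ρ → ρ ≤ ρ₁ →
        ∀ X : ℝ → Fin 5 → ℝ, X 0 = delayInit →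
        (∀ t, HasDerivAt X (rotorCircuit K M ε ρ (X t)) t) →
        ∃ tc : ℝ, |tc - Real.sqrt 2| ≤ C * Real.log K / M ∧
          (∀ t ∈ Set.Icc 0 tc,
            |X t 0 - 1| ≤ C / K ^ 10 ∧ ∀ i : Fin 5, i ≠ 0 → |X t i| ≤ C / K ^ 10) ∧
          (∀ t, tc + C * Real.log K / M + 1 / Real.sqrt K ≤ t →
            |X t 4 - 1| ≤ C / K ^ 10 ∧ ∀ i : Fin 5, i ≠ 4 → |X t i| ≤ C / K ^ 10) := by
  have hB : (0 : ℝ) ≤ 2 * 20 ^ 42 * (Nat.factorial 42 : ℝ) := by positivity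
  refine ⟨3000, by norm_num, 2 * 20 ^ 42 * (Nat.factorial 42 : ℝ) + 16, by linarith, ?_⟩
  intro K hK M hML hMK ε hε hε100
  obtain ⟨hK16, hM0, -, hlog2, -⟩ := Thm53With.family_params hK hML
  have hK0 : 0 < K := by linarith
  set A : ℝ := ε ^ 2 * exp (-(18 * M)) / (64 * M) with hA
  have hA0 : 0 < A := by positivity
  refine ⟨sqrt (sqrt A), by positivity, ?_⟩
  intro ρ hρ hρle X h0 hX
  have hρexp : ρ ^ 4 ≤ A := by
    have h4 : ρ ^ 4 ≤ sqrt (sqrt A) ^ 4 := pow_le_pow_left₀ hρ.le hρle 4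
    have hs : sqrt (sqrt A) ^ 4 = A := by
      rw [show (4 : ℕ) = 2 * 2 from rfl, pow_mul, sq_sqrt (sqrt_nonneg A), sq_sqrt hA0.le]
    rwa [hs] at h4
  obtain ⟨tc, htc, hearly, hlate⟩ := transition_explicit hK hML hMK hε hε100 hρ hρexp h0 hX
  have hC10 : (200 : ℝ) / K ^ 10 ≤ 3000 / K ^ 10 :=
    div_le_div_of_nonneg_right (by norm_num) (by positivity)
  have hLM0 : 0 ≤ Real.log K / M := div_nonneg (by linarith) hM0.le
  refine ⟨tc, ?_, ?_, ?_⟩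
  · refine htc.trans ?_
    rw [mul_div_assoc, mul_div_assoc]
    nlinarith
  · intro t ht
    obtain ⟨ha, hi⟩ := hearly t ht
    exact ⟨ha.trans hC10, fun i hi0 => (hi i hi0).trans hC10⟩
  · intro t ht
    have hδC : 880 * Real.log K / M ≤ 3000 * Real.log K / M := by
      rw [mul_div_assoc, mul_div_assoc]; nlinarith
    obtain ⟨he, hi⟩ := hlate t (by linarith)
    exact ⟨he.trans hC10, fun i hi0 => (hi i hi0).trans hC10⟩

/- **Consistency: the diagonal `ρ = ε`** (an `example`, deliberately not a declaration: the
statement below IS the tree's `Thm53With.transitionWith_explicit`). Under its hypotheses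
(`ε ≤ e^{-10M}/K¹⁰⁰`, which gives `ε ≤ K⁻¹⁰⁰` and `ε⁴ ≤ ε²e^{-18M}/(64M)` by `Thm53With.eps_facts`)
the two-scale theorem at `ρ = ε` re-derives the tree's conclusion for `delayCircuitWith K M ε`
(`rotorCircuit_self`). [cite: Tao2016AveragedNS, Theorem 5.3, §5.5] -/
example {K M ε : ℝ} {X : ℝ → Fin 5 → ℝ}
    (hK : 2 * 20 ^ 42 * (Nat.factorial 42 : ℝ) + 16 ≤ K) (hML : 3000 * Real.log K ≤ M)
    (hMK : M ≤ K ^ 10) (hε : 0 < ε) (hεle : ε ≤ exp (-(10 * M)) / K ^ 100)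
    (h0 : X 0 = delayInit) (hX : ∀ t, HasDerivAt X (delayCircuitWith K M ε (X t)) t) :
    ∃ tc : ℝ, |tc - Real.sqrt 2| ≤ 24 * Real.log K / M ∧
      (∀ t ∈ Set.Icc 0 tc,
        |X t 0 - 1| ≤ 200 / K ^ 10 ∧ ∀ i : Fin 5, i ≠ 0 → |X t i| ≤ 200 / K ^ 10) ∧
      (∀ t, tc + 880 * Real.log K / M + 1 / Real.sqrt K ≤ t →
        |X t 4 - 1| ≤ 200 / K ^ 10 ∧ ∀ i : Fin 5, i ≠ 4 → |X t i| ≤ 200 / K ^ 10) := by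
  obtain ⟨hK16, hM0, -⟩ := Thm53With.family_params hK hML
  obtain ⟨-, -, hε100, hεexp⟩ := Thm53With.eps_facts hK16 hM0 hMK hε hεle
  have hρexp : ε ^ 4 ≤ ε ^ 2 * exp (-(18 * M)) / (64 * M) := by
    rw [mul_div_assoc, show ε ^ 4 = ε ^ 2 * ε ^ 2 by ring]
    exact mul_le_mul_of_nonneg_left hεexp (sq_nonneg _)
  have hX' : ∀ t, HasDerivAt X (rotorCircuit K M ε ε (X t)) t := fun t => by
    rw [rotorCircuit_self]; exact hX t
  exact transition_explicit hK hML hMK hε hε100 hε hρexp h0 hX'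

end Summit.NavierStokesRegularity.FluidComputer.RotorKnob
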